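import Mathlib
import HarnessLib
import Literature.Analysis.FluidPDE.VectorCalculus
import Literature.Analysis.FluidPDE.VectorCalculusProofs
import Literature.Analysis.FluidPDE.VorticityCalculus
import Literature.Analysis.FluidPDE.AncientSimilarityVorticity
import Literature.Analysis.FluidPDE.HarmonicMeanValue
import Summits.NavierStokesRegularity.NavierStokesRegularity.Theorems.UnthreadedDoorVorticityOfClass
import Summits.NavierStokesRegularity.NavierStokesRegularity.Theorems.UnthreadedDoorAntidynamoLambRadial
import Summits.NavierStokesRegularity.NavierStokesRegularity.Theorems.UnthreadedDoorAntidynamoRadialToroidalLaplacian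

/-!
# Route `UnthreadedDoor` / `ThreadingFlux`, crux `PoloidalLiouville` (stmt-NavierStokesRegularity-1222), antidynamo v2 skeleton,
# rung `stub_singleDegreeRung`, EVEN degree — (E1d) THE SLICE IDENTITY: the vorticity equation of a slice in normal form IS the
# single-degree vorticity identity `hid` with explicit radial coefficients `c, e`

Support file (census instrument decomp-ns-census-1 g34, cell decomp-ns; `--supports stmt-NavierStokesRegularity-1222 --as helper`; 0 kit).

DYNAMIC HALF of the (E1) assembly.  Data: the rung's class (bounded ancient mild solution, measurable slices, jointly smooth ⟹ the vorticity
formulation `∂ₜω + (v·∇)ω = (ω·∇)v + Δω` on `(−∞,0) × ℝ³`, p629171 `isVorticitySolutionOn_Iio`); a jointly smooth AMPLITUDE `Φ` on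
`(−∞,0) × (0,∞)` with `curl (v s) x = Φ(s, ‖x − x₀‖)•(∇Q × ·)(x − x₀)` off the centre at every `s < 0` (`Q` the profile, smooth, harmonic,
positively homogeneous of degree `l` with Euler's identity); and at the slice `t` the NORMAL FORM `v t (x₀ + y) = (a(‖y‖)Q(y))•y + k(‖y‖)•∇Q(y)`
(`a, k ∈ C^∞(0,∞)`; census `evenRung_normalForm`).  Then, with `G = Φ(t, ·)`, `B = G·(a r² + l k)`,

  `c(r) := B′(r)/r + 2l·G(r)a(r)`,   `e(r) := ∂ₛΦ(t, r) − G″(r) − (2l+2)G′(r)/r`,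

both differentiable on `(0,∞)`, the identity `−(c(r)Q(y))•(∇Q × y) − (G(r)k(r))•(∇|∇Q|² × y) − e(r)•(∇Q × y) = 0` holds for every `y ≠ 0`
— VERBATIM the hypothesis `hid` of `singleDegreeRung_of_sliceData` / `evenRung_slice_const_of_rung` (p811987) with `ĝ := G`.
[`∂ₜω = (∂ₛΦ)•Λ` (representation along the time line), `Δω = (G″ + (2l+2)G′/r)•Λ` (p800175's sibling `laplacian_radial_smul_cross_gradient`),
`(ω·∇)v − (v·∇)ω = curl(v × ω)` (`curl_cross_apply`, `div v = div ω = 0`) `= −((B′/r + 2lGa)Q)•Λ − (Gk)•(∇|∇Q|² × y)` (`curl_lamb_eq_radial`,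
p800175).]

* ★★ `evenRung_sliceIdentity` — the statement above (curl of a translate via `fderiv_comp_add_left`).

HONEST LABEL: bookkeeping of tree identities (vorticity equation of the class, Lamb-vector curl, radial Laplacian) serving the open EVEN-degree
rung of an S-free Liouville engine; the rung, the wall `stub_scalarLiouville`, `PoloidalLiouville` (1222) and Navier–Stokes regularity are NOT
touched (crux 1222 is INCOMPARABLE with the summit; descent inside the door's cone, decorative for the summit).  Nothing here proves
NavierStokesRegularity. [folklore]
-/

noncomputable section

-- the summit and its single sub-problem share the name (CONVENTIONS §1), as in every Theorems file
set_option linter.dupNamespace false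

open scoped Topology InnerProductSpace RealInnerProductSpace ContDiff Laplacian
open Filter Set Metric MeasureTheory Function
open Literature.Analysis.FluidPDE

namespace Summit.NavierStokesRegularity.NavierStokesRegularity.Theorems.PoloidalLiouville.Antidynamo

open Summit.NavierStokesRegularity.NavierStokesRegularity.Theorems.PoloidalLiouville (isVorticitySolutionOn_Iio)

/-- ★★ **THE SLICE IDENTITY (E1d).**  See the module docstring: under the rung's class hypotheses, a jointly smooth amplitude `Φ` representing
the vorticity off the centre at all times, and the normal form of the slice `t`, the radial coefficients
`c = B′/r + 2lGa`, `e = ∂ₛΦ(t,·) − G″ − (2l+2)G′/r` are differentiable on `(0,∞)` and satisfy the single-degree vorticity identity `hid`.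
[folklore] -/
theorem evenRung_sliceIdentity
    (v : ℝ → EuclideanSpace ℝ (Fin 3) → EuclideanSpace ℝ (Fin 3)) (x₀ : EuclideanSpace ℝ (Fin 3))
    (hB : Literature.Analysis.FluidPDE.IsBoundedAncientMildSolution 1 v)
    (hm : ∀ t < 0, AEStronglyMeasurable (v t) volume)
    (hsm : ContDiffOn ℝ (⊤ : ℕ∞) (Function.uncurry v) (Set.Iio 0 ×ˢ Set.univ))
    {Q : EuclideanSpace ℝ (Fin 3) → ℝ} (hQ : ContDiff ℝ ∞ Q) {l : ℕ}
    (hhom : ∀ r : ℝ, 0 < r → ∀ y : EuclideanSpace ℝ (Fin 3), Q (r • y) = r ^ l * Q y)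
    (hEuler : ∀ z : EuclideanSpace ℝ (Fin 3), ⟪gradient Q z, z⟫ = (l : ℝ) * Q z) (hharm : ∀ z, (Δ Q) z = 0)
    {Φ : ℝ → ℝ → ℝ} (hΦ : ContDiffOn ℝ ∞ (Function.uncurry Φ) (Iio 0 ×ˢ Ioi 0))
    (hrepr : ∀ s < 0, ∀ x : EuclideanSpace ℝ (Fin 3), x ≠ x₀ →
      curl (v s) x = Φ s ‖x - x₀‖ • cross (gradient Q (x - x₀)) (x - x₀))
    {t : ℝ} (ht : t < 0) {a k : ℝ → ℝ} (ha : ContDiffOn ℝ ∞ a (Ioi 0)) (hk : ContDiffOn ℝ ∞ k (Ioi 0))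
    (hnf : ∀ y : EuclideanSpace ℝ (Fin 3), v t (x₀ + y) = (a ‖y‖ * Q y) • y + k ‖y‖ • gradient Q y) :
    ∃ c e : ℝ → ℝ, (∀ r, 0 < r → DifferentiableAt ℝ c r) ∧ (∀ r, 0 < r → DifferentiableAt ℝ e r) ∧
      ∀ y : EuclideanSpace ℝ (Fin 3), y ≠ 0 →
        -((c ‖y‖ * Q y) • cross (gradient Q y) y) -
          (Φ t ‖y‖ * k ‖y‖) • cross (gradient (fun z : EuclideanSpace ℝ (Fin 3) => ⟪gradient Q z, gradient Q z⟫) y) y -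
          e ‖y‖ • cross (gradient Q y) y = 0 := by
  -- ### the amplitude at the slice and its time derivative, as smooth functions of `r`
  set S : Set (ℝ × ℝ) := Iio 0 ×ˢ Ioi 0 with hS
  have hSo : IsOpen S := isOpen_Iio.prod isOpen_Ioi
  set Ψ : ℝ × ℝ → ℝ := Function.uncurry Φ with hΨ
  set G : ℝ → ℝ := Φ t with hGdef
  have hslice : ∀ {f : ℝ × ℝ → ℝ}, ContDiffOn ℝ ∞ f S → ContDiffOn ℝ ∞ (fun r => f (t, r)) (Ioi 0) := by
    intro f hf
    exact hf.comp (contDiffOn_const.prodMk contDiffOn_id) fun r hr => mk_mem_prod ht hr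
  have hG : ContDiffOn ℝ ∞ G (Ioi 0) := hslice hΦ
  have hΨ' : ContDiffOn ℝ ∞ (fun p => fderiv ℝ Ψ p) S := ((contDiffOn_infty_iff_fderiv_of_isOpen hSo).1 hΦ).2
  set D : ℝ → ℝ := fun r => fderiv ℝ Ψ (t, r) ((1 : ℝ), (0 : ℝ)) with hDdef
  have hD : ContDiffOn ℝ ∞ D (Ioi 0) :=
    (hΨ'.comp (contDiffOn_const.prodMk contDiffOn_id) fun r hr => mk_mem_prod ht hr).clm_apply contDiffOn_const
  have hDeq : ∀ r, 0 < r → HasDerivAt (fun s => Φ s r) (D r) t := by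
    intro r hr
    have hdiff : DifferentiableAt ℝ Ψ (t, r) :=
      (hΦ.differentiableOn (by simp)).differentiableAt (hSo.mem_nhds (mk_mem_prod ht hr))
    have hline : HasDerivAt (fun s : ℝ => ((s, r) : ℝ × ℝ)) ((1 : ℝ), (0 : ℝ)) t :=
      (hasDerivAt_id t).prodMk (hasDerivAt_const t r)
    exact hdiff.hasFDerivAt.comp_hasDerivAt t hline
  -- ### smoothness bookkeeping on `(0,∞)`
  have hdA : ∀ {f : ℝ → ℝ}, ContDiffOn ℝ ∞ f (Ioi 0) → ∀ r, 0 < r → DifferentiableAt ℝ f r := fun hf r hr =>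
    (hf.differentiableOn (by simp)).differentiableAt (Ioi_mem_nhds hr)
  have hderiv : ∀ {f : ℝ → ℝ}, ContDiffOn ℝ ∞ f (Ioi 0) → ContDiffOn ℝ ∞ (deriv f) (Ioi 0) := fun hf =>
    ((contDiffOn_infty_iff_deriv_of_isOpen isOpen_Ioi).1 hf).2
  have hid' : ContDiffOn ℝ ∞ (fun r : ℝ => r) (Ioi 0) := contDiffOn_id
  set B : ℝ → ℝ := fun r => G r * (a r * r ^ 2 + (l : ℝ) * k r) with hBdef
  have hBs : ContDiffOn ℝ ∞ B (Ioi 0) := hG.mul ((ha.mul (hid'.pow 2)).add (contDiffOn_const.mul hk))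
  set c : ℝ → ℝ := fun r => deriv B r / r + 2 * (l : ℝ) * G r * a r with hcdef
  set e : ℝ → ℝ := fun r => D r - (deriv (deriv G) r + (2 * (l : ℝ) + 2) * deriv G r / r) with hedef
  have hcs : ContDiffOn ℝ ∞ c (Ioi 0) :=
    ((hderiv hBs).div hid' fun r hr => ne_of_gt hr).add (((contDiffOn_const.mul hG)).mul ha)
  have hes : ContDiffOn ℝ ∞ e (Ioi 0) :=
    hD.sub ((hderiv (hderiv hG)).add ((contDiffOn_const.mul (hderiv hG)).div hid' fun r hr => ne_of_gt hr))
  refine ⟨c, e, hdA hcs, hdA hes, fun y hy => ?_⟩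
  -- ### the vorticity equation at `(t, x₀ + y)`
  have hr : 0 < ‖y‖ := norm_pos_iff.2 hy
  have hx : x₀ + y ≠ x₀ := fun h => hy (by simpa using h)
  have hsm' : IsSmoothSpaceTimeOn (Iio 0) v := hsm
  have hu : ContDiff ℝ ∞ (v t) := hsm'.contDiff_slice ht
  have hu2 : ContDiff ℝ 2 (v t) := hu.of_le (by norm_cast)
  have hω1 : ContDiff ℝ 1 (curl (v t)) := contDiff_curl (n := 1) (hu.of_le (by norm_cast))
  have hdivu : VectorCalculus.IsDivFree (v t) :=
    (hB.isAncientMildSolution.1 t ht).isDivFree_of_contDiff (hu.of_le (by norm_cast))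
  have hVE := (isVorticitySolutionOn_Iio hB hm hsm).vorticity_eq t ht (x₀ + y)
  simp only [timeDerivWithin_apply, vorticity_apply] at hVE
  -- (T1) the time derivative
  have hT1 : derivWithin (fun s => curl (v s) (x₀ + y)) (Iio 0) t = D ‖y‖ • cross (gradient Q y) y := by
    rw [derivWithin_of_isOpen isOpen_Iio ht]
    have hev : (fun s => curl (v s) (x₀ + y)) =ᶠ[𝓝 t] fun s => Φ s ‖y‖ • cross (gradient Q y) y := by
      filter_upwards [isOpen_Iio.mem_nhds ht] with s hs
      rw [hrepr s hs _ hx, add_sub_cancel_left]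
    rw [hev.deriv_eq, ((hDeq ‖y‖ hr).smul_const _).deriv]
  -- (T3) the Laplacian
  have hT3 : (Δ (curl (v t))) (x₀ + y) =
      (deriv (deriv G) ‖y‖ + (2 * (l : ℝ) + 2) * deriv G ‖y‖ / ‖y‖) • cross (gradient Q y) y := by
    rw [← laplacian_comp_const_add (curl (v t)) x₀ y]
    have hev : (fun z => curl (v t) (x₀ + z)) =ᶠ[𝓝 y] fun z => G ‖z‖ • cross (gradient Q z) z := by
      filter_upwards [isOpen_compl_singleton.mem_nhds hy] with z hz
      have hz0 : z ≠ 0 := hz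
      have hxz : x₀ + z ≠ x₀ := fun h => hz0 (by simpa using h)
      rw [hrepr t ht _ hxz, add_sub_cancel_left]
    rw [(InnerProductSpace.laplacian_congr_nhds hev).eq_of_nhds,
      laplacian_radial_smul_cross_gradient (hQ.of_le (by norm_cast)) hhom hharm (hG.of_le (by norm_cast)) hy]
  -- (T2) the convective terms are the curl of the Lamb vector
  have hT2 : convect (curl (v t)) (v t) (x₀ + y) - convect (v t) (curl (v t)) (x₀ + y) =
      curl (fun z => cross (v t z) (curl (v t) z)) (x₀ + y) := by
    rw [curl_cross_apply ((hu.differentiable (by simp)) _) ((hω1.differentiable one_ne_zero) _), hdivu (x₀ + y),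
      divergence_curl_eq_zero_holds (v t) hu2 (x₀ + y), zero_smul, zero_smul, sub_zero, add_zero, convect, convect]
  have hLamb : curl (fun z => cross (v t z) (curl (v t) z)) (x₀ + y) =
      -((Q y * deriv B ‖y‖ / ‖y‖ + 2 * (l : ℝ) * G ‖y‖ * a ‖y‖ * Q y) • cross (gradient Q y) y) -
        (G ‖y‖ * k ‖y‖) • cross (gradient (fun z : EuclideanSpace ℝ (Fin 3) => ⟪gradient Q z, gradient Q z⟫) y) y := by
    have htr : ∀ F : EuclideanSpace ℝ (Fin 3) → EuclideanSpace ℝ (Fin 3), curl (fun z => F (x₀ + z)) y = curl F (x₀ + y) :=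
      fun F => by simp only [curl, fderiv_comp_add_left]
    rw [← htr (fun z => cross (v t z) (curl (v t) z))]
    have hev : (fun z => cross (v t (x₀ + z)) (curl (v t) (x₀ + z))) =ᶠ[𝓝 y] fun z =>
        cross ((a ‖z‖ * Q z) • z + k ‖z‖ • gradient Q z) (G ‖z‖ • cross (gradient Q z) z) := by
      filter_upwards [isOpen_compl_singleton.mem_nhds hy] with z hz
      have hz0 : z ≠ 0 := hz
      have hxz : x₀ + z ≠ x₀ := fun h => hz0 (by simpa using h)
      rw [hnf z, hrepr t ht _ hxz, add_sub_cancel_left]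
    rw [curl_eq_curlCLM, hev.fderiv_eq, ← curl_eq_curlCLM,
      curl_lamb_eq_radial (hQ.of_le (by norm_cast)) hEuler hy (hdA ha _ hr) (hdA hk _ hr) (hdA hG _ hr)]
  -- ### assemble
  rw [hT1, hT3, one_smul] at hVE
  -- `hVE : D • Λ + convect v ω = convect ω v + lap • Λ`
  have key : D ‖y‖ • cross (gradient Q y) y =
      (-((Q y * deriv B ‖y‖ / ‖y‖ + 2 * (l : ℝ) * G ‖y‖ * a ‖y‖ * Q y) • cross (gradient Q y) y) -
        (G ‖y‖ * k ‖y‖) • cross (gradient (fun z : EuclideanSpace ℝ (Fin 3) => ⟪gradient Q z, gradient Q z⟫) y) y) +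
      (deriv (deriv G) ‖y‖ + (2 * (l : ℝ) + 2) * deriv G ‖y‖ / ‖y‖) • cross (gradient Q y) y := by
    rw [← hLamb, ← hT2]
    have := hVE
    -- `this : D•Λ + cv = cw + lap•Λ`; goal: `D•Λ = (cw - cv) + lap•Λ`
    rw [sub_add_eq_add_sub, eq_sub_iff_add_eq, this]
  have hcQ : c ‖y‖ * Q y = Q y * deriv B ‖y‖ / ‖y‖ + 2 * (l : ℝ) * G ‖y‖ * a ‖y‖ * Q y := by
    rw [hcdef]; ring
  have he : e ‖y‖ = D ‖y‖ - (deriv (deriv G) ‖y‖ + (2 * (l : ℝ) + 2) * deriv G ‖y‖ / ‖y‖) := rfl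
  rw [hcQ, he, sub_smul, key]
  module

end Summit.NavierStokesRegularity.NavierStokesRegularity.Theorems.PoloidalLiouville.Antidynamo

end
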